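import Summits.CriticalPhenomena.PercolationContinuityZ3.Theorems.PercNearOneGluingNoHeavyQuantThreeRootGateCoupling
import HarnessLib

/-!
# QUANT lane R8, T-DEC: THE TIED CORE BELOW AND ABOVE THE BAND — two six-component gate-coupling identities flanking lead g44's tied-core
# identity (`tiedCore_gateCoupling`, valid on the band `2f ≤ κ ≤ 1`): B1 (`f ≤ κ < 1`, no attached-version carrier) and A1 (`κ ≥ 1`, the
# corner that contains E* = o[19/20](R[19/20](R[1/2]))³), census-2 g72

builds on p205010 (kernel theorem, internal audit signed; external expert review pending)

Support file (`--supports stmt-CriticalPhenomena-4575`), QUANT lane seat prim-quant-census-2 (gen 72); memo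
`run/shared/lean/prim/quant/prim-quant-census-2-g72/CORE-G72.md` §3.  Pure algebra (pointwise identities of finitely supported functions), standard
axioms, no sorries, no definitions.  Same setting and vocabulary as `…QuantTiedCoreCoupling` (lead g44): three siblings `tᵢ = gate_q ρᵢ` with a COMMON root gate
`q`, outer gate `a`, `m = aq`, each opened law split at ONE internal gate of common value `s`, `ρᵢ = (1−s)ρᵢ⁻ + sρᵢ⁺`, free mean-ratio parameter `r`
(`= R_σ/R₋` in the application); write `S̃ = 3m(1+sr)` (`= S/R₋`), `κ = (3m−2)(1+sr)`, `E = m(1+sr)(2+s) − (2+s+2sr)`, `F = m(1+sr)(1+2s) − (1+2s+2sr)`,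
`w_P = ((1−q)/(1−m))²`.  SHAPES (all symmetrised over the three positions): `N = gate_m(ρ₁∗ρ₂∗ρ₃)`, `P = ⊗ gate_m ρᵢ`, the DROPPED carrier
`U_k = ρᵢ∗ρⱼ∗gate_κ ρ_k⁻`, the ATTACHED carrier `D_k = ρᵢ∗ρⱼ∗gate_{κ/(1+r)} ρ_k⁺`, the RE-TUNED dropped carrier `U′_k = ρᵢ^{(h₂)}∗ρⱼ^{(h₂)}∗ρ_k⁻` with
`ρ^{(h)} := (h/s)ρ + ((s−h)/s)ρ⁻ = (1−h)ρ⁻ + hρ⁺` and `h₂ = (S̃−3)/(2r)` (the two present trees' top gates re-tuned UP so that the bare third tree can be SURE),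
and the VERSION BLOCKS `VB_UUD = gate_{S̃/(3+r)}(ρ⁻∗ρ⁻∗ρ⁺)`, `VB_UDD = gate_{S̃/(3+2r)}(ρ⁻∗ρ⁺∗ρ⁺)`, `VB_DDD = gate_{S̃/(3(1+r))}(ρ⁺∗ρ⁺∗ρ⁺)` (sym.).

* **`belowBand_gateCoupling`** (B1):  `gate_a(t₁∗t₂∗t₃) = w_N N + w_P P + (w_U/3)ΣU_k + (w_UUD/3)ΣVB_UUD,k + (w_UDD/3)ΣVB_UDD,k + w_DDD VB_DDD`,
  `w_U = 3aq²(1−a)(1−q)/((1−m)(1−κ))`, `w_UUD = qs(1−s)(1−a)(1−q)(3m−2)(3+r)/((1−m)(1−κ))`, `w_UDD = 2qs²(1−a)(1−q)(3m−2)(3+2r)/((1−m)(1−κ))`,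
  `w_DDD = 3qs³(1−a)(1−q)(3m−2)(1+r)/((1−s)(1−m)(1−κ))`, `w_N = 1 −` the rest.  All but `w_N` are `≥ 0` for `3m > 2`, `κ < 1`; as a certificate it is valid on
  `{f ≤ κ < 1, w_N ≥ 0}` (2-chains: from `m = 2(1+s)/(3+2s)`, below the band's bottom `2(1+s)/(3+s)`).
* **`aboveBand_gateCoupling`** (A1; stated in Lean for `r = 1` — root-part mean = attached mean, the 2-chain case; the general-`r` weights below
  are verified exactly in the memo and kept for the typer): `gate_a(t₁∗t₂∗t₃) = w_N N + w_P P + (w_D/3)ΣD_k + (w_U′/3)ΣU′_k + (w_UDD/3)ΣVB_UDD,k + w_DDD VB_DDD`,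
  `w_D = 3aq²(1−a)(1−q)(1+r)/((1−m)(1+r−κ))`, `w_U′ = 4aq²r²(1−a)(1−q)(1−s)³(3m−2)(1+sr)/((1−m)(1+r−κ)(3+2r−S̃)(−E))`,
  `w_DDD = 2qs²(1−a)(1−q)(3m−2)(1+r)(κ−1)/((1−m)(1+r−κ)(−E))`, `w_UDD = q(1−a)(1−q)(1−s)(3m−2)(3+2r)(κ−1)F/((1−m)(1+r−κ)(3+2r−S̃)E)`, `w_N = 1 −` the rest;
  all but `w_N` are `≥ 0` for `κ ≥ 1`, `E < 0`; valid on `{κ ≥ 1, E < 0, w_N ≥ 0}`; at `κ = 1` it IS the band identity (`h₂ = s`, VB weights `0`).  E*: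
  `(w_N, w_P, w_D, w_U′, w_UDD, w_DDD) = (.46472, .26298, .14051, .11448, .00758, .00973)`.  The determinant of the family is `∝ E`, and `E = 0`, i.e.
  `m* = (2+s+2sr)/((1+sr)(2+s))`, is (numerically, ±10⁻³ on three lines, plateau residuals beyond) the boundary of what ANY family with one opened gate per tree
  can certify (memo §4).
DERIVATION: lead g44's A-power bookkeeping (box = `1 + cX + ηY`, `A = 1 + X + sY`): both families live on the monomials `{1, A, A², A³, A²Y, AY², Y³}` (the
carriers add `A²Y`; `U′` and the version blocks add `AY², Y³`), so `4 + 3` linear equations fix six weights; solved by Cramer over `ℚ[a,q,s,r]` (memo code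
cf_ay_r2.py), verified exactly on the 10 types at 200 random rationals and MULTILINEARLY with distinct random tree contents (check_A1_multilinear.py).  Lean:
`lconv3_gate_expand` ×2, the one-slot version lemmas of `…TiedCoreCoupling`, the three slot-linearity lemmas below, `field_simp; ring`.
HONEST STATUS: identities only (the DEC consequences inside `GateStepN`'s binder are the typer's, as `…QuantTiedCoreStep` for the band); `SiblingStep`,
`GateStepN`, `FarTreeRow` OPEN; RATE class log\* / honest sentence unchanged.  [this work]; band identity and helpers: lead g44; two-root identity: arm-1 g45
(this lane).  Nothing here is a published result.  The gluing rows served [cite: KozmaNitzan2024, Conjecture 3 (p. 15)]; product measure [cite: Grimmett1999, §1.3 p. 10].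
-/

noncomputable section

namespace Summit.CriticalPhenomena.PercolationContinuityZ3.Theorems

namespace Quant

namespace LawDec

/-! ### Slot linearity of the triple convolution -/

/-- linearity of `ρ₁ ∗ ρ₂ ∗ ρ₃` in the LEFT slot. [this work] -/
theorem lconv3_lin_left (M₁ M₂ M₃ : ℕ) (u v : ℝ) (A B ρ₂ ρ₃ : ℕ → ℝ) (h : ℕ) :
    lconv (M₁ + M₂) M₃ (lconv M₁ M₂ (fun k => u * A k + v * B k) ρ₂) ρ₃ h
      = u * lconv (M₁ + M₂) M₃ (lconv M₁ M₂ A ρ₂) ρ₃ h + v * lconv (M₁ + M₂) M₃ (lconv M₁ M₂ B ρ₂) ρ₃ h := by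
  have e : lconv M₁ M₂ (fun k => u * A k + v * B k) ρ₂ = fun k => u * lconv M₁ M₂ A ρ₂ k + v * lconv M₁ M₂ B ρ₂ k :=
    funext fun k => lconv_lin_left M₁ M₂ u v A B ρ₂ k
  rw [e, lconv_lin_left]

/-- linearity of `ρ₁ ∗ ρ₂ ∗ ρ₃` in the MIDDLE slot. [this work] -/
theorem lconv3_lin_mid (M₁ M₂ M₃ : ℕ) (u v : ℝ) (ρ₁ A B ρ₃ : ℕ → ℝ) (h : ℕ) :
    lconv (M₁ + M₂) M₃ (lconv M₁ M₂ ρ₁ (fun k => u * A k + v * B k)) ρ₃ h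
      = u * lconv (M₁ + M₂) M₃ (lconv M₁ M₂ ρ₁ A) ρ₃ h + v * lconv (M₁ + M₂) M₃ (lconv M₁ M₂ ρ₁ B) ρ₃ h := by
  have e : lconv M₁ M₂ ρ₁ (fun k => u * A k + v * B k) = fun k => u * lconv M₁ M₂ ρ₁ A k + v * lconv M₁ M₂ ρ₁ B k :=
    funext fun k => lconv_lin_right M₁ M₂ u v ρ₁ A B k
  rw [e, lconv_lin_left]

/-- linearity of `ρ₁ ∗ ρ₂ ∗ ρ₃` in the RIGHT slot. [this work] -/
theorem lconv3_lin_right (M₁ M₂ M₃ : ℕ) (u v : ℝ) (ρ₁ ρ₂ A B : ℕ → ℝ) (h : ℕ) :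
    lconv (M₁ + M₂) M₃ (lconv M₁ M₂ ρ₁ ρ₂) (fun k => u * A k + v * B k) h
      = u * lconv (M₁ + M₂) M₃ (lconv M₁ M₂ ρ₁ ρ₂) A h + v * lconv (M₁ + M₂) M₃ (lconv M₁ M₂ ρ₁ ρ₂) B h :=
  lconv_lin_right (M₁ + M₂) M₃ u v (lconv M₁ M₂ ρ₁ ρ₂) A B h

/-! ### One-slot version components (as in `…QuantTiedCoreCoupling`, restated privately: that module has no olean on the check farm at filing time) -/

/-- `ρ₁ ∗ ρ₂ ∗ gate_g ν = g·(ρ₁∗ρ₂∗ν) + (1−g)·(ρ₁∗ρ₂)`. [this work] -/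
private theorem l3_version_right (M₁ M₂ M₃ : ℕ) (ρ₁ ρ₂ ν : ℕ → ℝ) (g : ℝ) (h : ℕ) :
    lconv (M₁ + M₂) M₃ (lconv M₁ M₂ ρ₁ ρ₂) (gate ν g) h
      = g * lconv (M₁ + M₂) M₃ (lconv M₁ M₂ ρ₁ ρ₂) ν h + (1 - g) * lconv M₁ M₂ ρ₁ ρ₂ h :=
  lconv_gate_right (M₁ + M₂) M₃ (lconv M₁ M₂ ρ₁ ρ₂) ν g (fun k hk => lconv_eq_zero _ _ _ _ k hk) h

/-- `gate_g ν ∗ ρ₂ ∗ ρ₃ = g·(ν∗ρ₂∗ρ₃) + (1−g)·(ρ₂∗ρ₃)`. [this work] -/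
private theorem l3_version_left (M₁ M₂ M₃ : ℕ) (ν ρ₂ ρ₃ : ℕ → ℝ) (g : ℝ)
    (h₂M : ∀ h, M₂ < h → ρ₂ h = 0) (h : ℕ) :
    lconv (M₁ + M₂) M₃ (lconv M₁ M₂ (gate ν g) ρ₂) ρ₃ h
      = g * lconv (M₁ + M₂) M₃ (lconv M₁ M₂ ν ρ₂) ρ₃ h + (1 - g) * lconv M₂ M₃ ρ₂ ρ₃ h := by
  have e : lconv M₁ M₂ (gate ν g) ρ₂ = fun k => g * lconv M₁ M₂ ν ρ₂ k + (1 - g) * ρ₂ k :=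
    funext (lconv_gate_left M₁ M₂ ν ρ₂ g h₂M)
  rw [e, lconv_lin_left, lconv_top_left_of_le M₂ (M₁ + M₂) M₃ ρ₂ ρ₃ (by omega) h₂M h]

/-- `ρ₁ ∗ gate_g ν ∗ ρ₃ = g·(ρ₁∗ν∗ρ₃) + (1−g)·(ρ₁∗ρ₃)`. [this work] -/
private theorem l3_version_mid (M₁ M₂ M₃ : ℕ) (ρ₁ ν ρ₃ : ℕ → ℝ) (g : ℝ)
    (h₁M : ∀ h, M₁ < h → ρ₁ h = 0) (h : ℕ) :
    lconv (M₁ + M₂) M₃ (lconv M₁ M₂ ρ₁ (gate ν g)) ρ₃ h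
      = g * lconv (M₁ + M₂) M₃ (lconv M₁ M₂ ρ₁ ν) ρ₃ h + (1 - g) * lconv M₁ M₃ ρ₁ ρ₃ h := by
  have e : lconv M₁ M₂ ρ₁ (gate ν g) = fun k => g * lconv M₁ M₂ ρ₁ ν k + (1 - g) * ρ₁ k :=
    funext (lconv_gate_right M₁ M₂ ρ₁ ν g h₁M)
  rw [e, lconv_lin_left, lconv_top_left_of_le M₁ (M₁ + M₂) M₃ ρ₁ ρ₃ (by omega) h₁M h]

/-! ### B1: the tied core below the band -/

set_option maxRecDepth 8192 in
/-- **THE BELOW-BAND TIED-CORE IDENTITY (B1)** — see the file header. [this work] -/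
theorem belowBand_gateCoupling (M₁ M₂ M₃ : ℕ) (ρ₁ ρ₂ ρ₃ ρ₁m ρ₂m ρ₃m ρ₁p ρ₂p ρ₃p : ℕ → ℝ) (q s a r : ℝ)
    (h₁M : ∀ h, M₁ < h → ρ₁ h = 0) (h₂M : ∀ h, M₂ < h → ρ₂ h = 0) (h₃M : ∀ h, M₃ < h → ρ₃ h = 0)
    (hs₁ : ρ₁ = fun k => (1 - s) * ρ₁m k + s * ρ₁p k) (hs₂ : ρ₂ = fun k => (1 - s) * ρ₂m k + s * ρ₂p k)
    (hs₃ : ρ₃ = fun k => (1 - s) * ρ₃m k + s * ρ₃p k)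
    (hm : 1 - a * q ≠ 0) (hs0 : s ≠ 0) (hs1 : 1 - s ≠ 0) (hr3 : 3 + r ≠ 0) (hr32 : 3 + 2 * r ≠ 0) (hr1 : 1 + r ≠ 0)
    (hκ : 1 - (3 * (a * q) - 2) * (1 + s * r) ≠ 0) (h : ℕ) :
    gate (lconv (M₁ + M₂) M₃ (lconv M₁ M₂ (gate ρ₁ q) (gate ρ₂ q)) (gate ρ₃ q)) a h
      = (1 - ((1 - q) / (1 - a * q)) ^ 2
            - (3 * a * q ^ 2 * (1 - a) * (1 - q)) / ((1 - a * q) * (1 - (3 * (a * q) - 2) * (1 + s * r)))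
            - (q * s * (1 - s) * (1 - a) * (1 - q) * (3 * (a * q) - 2) * (3 + r)) / ((1 - a * q) * (1 - (3 * (a * q) - 2) * (1 + s * r)))
            - (2 * q * s ^ 2 * (1 - a) * (1 - q) * (3 * (a * q) - 2) * (3 + 2 * r)) / ((1 - a * q) * (1 - (3 * (a * q) - 2) * (1 + s * r)))
            - (3 * q * s ^ 3 * (1 - a) * (1 - q) * (3 * (a * q) - 2) * (1 + r)) / ((1 - s) * (1 - a * q) * (1 - (3 * (a * q) - 2) * (1 + s * r))))
          * gate (lconv (M₁ + M₂) M₃ (lconv M₁ M₂ ρ₁ ρ₂) ρ₃) (a * q) h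
        + ((1 - q) / (1 - a * q)) ^ 2 * lconv (M₁ + M₂) M₃ (lconv M₁ M₂ (gate ρ₁ (a * q)) (gate ρ₂ (a * q))) (gate ρ₃ (a * q)) h
        + (a * q ^ 2 * (1 - a) * (1 - q)) / ((1 - a * q) * (1 - (3 * (a * q) - 2) * (1 + s * r)))
            * (lconv (M₁ + M₂) M₃ (lconv M₁ M₂ (gate ρ₁m ((3 * (a * q) - 2) * (1 + s * r))) ρ₂) ρ₃ h
              + lconv (M₁ + M₂) M₃ (lconv M₁ M₂ ρ₁ (gate ρ₂m ((3 * (a * q) - 2) * (1 + s * r)))) ρ₃ h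
              + lconv (M₁ + M₂) M₃ (lconv M₁ M₂ ρ₁ ρ₂) (gate ρ₃m ((3 * (a * q) - 2) * (1 + s * r))) h)
        + (q * s * (1 - s) * (1 - a) * (1 - q) * (3 * (a * q) - 2) * (3 + r)) / (3 * ((1 - a * q) * (1 - (3 * (a * q) - 2) * (1 + s * r))))
            * (gate (lconv (M₁ + M₂) M₃ (lconv M₁ M₂ ρ₁p ρ₂m) ρ₃m) (3 * (a * q) * (1 + s * r) / (3 + r)) h
              + gate (lconv (M₁ + M₂) M₃ (lconv M₁ M₂ ρ₁m ρ₂p) ρ₃m) (3 * (a * q) * (1 + s * r) / (3 + r)) h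
              + gate (lconv (M₁ + M₂) M₃ (lconv M₁ M₂ ρ₁m ρ₂m) ρ₃p) (3 * (a * q) * (1 + s * r) / (3 + r)) h)
        + (2 * q * s ^ 2 * (1 - a) * (1 - q) * (3 * (a * q) - 2) * (3 + 2 * r)) / (3 * ((1 - a * q) * (1 - (3 * (a * q) - 2) * (1 + s * r))))
            * (gate (lconv (M₁ + M₂) M₃ (lconv M₁ M₂ ρ₁m ρ₂p) ρ₃p) (3 * (a * q) * (1 + s * r) / (3 + 2 * r)) h
              + gate (lconv (M₁ + M₂) M₃ (lconv M₁ M₂ ρ₁p ρ₂m) ρ₃p) (3 * (a * q) * (1 + s * r) / (3 + 2 * r)) h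
              + gate (lconv (M₁ + M₂) M₃ (lconv M₁ M₂ ρ₁p ρ₂p) ρ₃m) (3 * (a * q) * (1 + s * r) / (3 + 2 * r)) h)
        + (3 * q * s ^ 3 * (1 - a) * (1 - q) * (3 * (a * q) - 2) * (1 + r)) / ((1 - s) * (1 - a * q) * (1 - (3 * (a * q) - 2) * (1 + s * r)))
            * gate (lconv (M₁ + M₂) M₃ (lconv M₁ M₂ ρ₁p ρ₂p) ρ₃p) (3 * (a * q) * (1 + s * r) / (3 * (1 + r))) h := by
  -- eliminate the attached versions: `ρ_kp = (1/s)ρ_k − ((1−s)/s)ρ_km`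
  have hp₁ : ρ₁p = fun k => (1 / s) * ρ₁ k + (-(1 - s) / s) * ρ₁m k := by
    funext k
    have e : ρ₁ k = (1 - s) * ρ₁m k + s * ρ₁p k := by rw [hs₁]
    rw [e]; field_simp; ring
  have hp₂ : ρ₂p = fun k => (1 / s) * ρ₂ k + (-(1 - s) / s) * ρ₂m k := by
    funext k
    have e : ρ₂ k = (1 - s) * ρ₂m k + s * ρ₂p k := by rw [hs₂]
    rw [e]; field_simp; ring
  have hp₃ : ρ₃p = fun k => (1 / s) * ρ₃ k + (-(1 - s) / s) * ρ₃m k := by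
    funext k
    have e : ρ₃ k = (1 - s) * ρ₃m k + s * ρ₃p k := by rw [hs₃]
    rw [e]; field_simp; ring
  rw [gate_apply _ a h, lconv3_gate_expand M₁ M₂ M₃ ρ₁ ρ₂ ρ₃ q q q h₁M h₂M h₃M h,
    gate_apply (lconv (M₁ + M₂) M₃ (lconv M₁ M₂ ρ₁ ρ₂) ρ₃) (a * q) h,
    lconv3_gate_expand M₁ M₂ M₃ ρ₁ ρ₂ ρ₃ (a * q) (a * q) (a * q) h₁M h₂M h₃M h,
    l3_version_left M₁ M₂ M₃ ρ₁m ρ₂ ρ₃ _ h₂M h, l3_version_mid M₁ M₂ M₃ ρ₁ ρ₂m ρ₃ _ h₁M h,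
    l3_version_right M₁ M₂ M₃ ρ₁ ρ₂ ρ₃m _ h]
  simp only [gate_apply]
  -- the seven version-block triples on the atoms `{ρ_k, ρ_km}`
  have xPMM : lconv (M₁ + M₂) M₃ (lconv M₁ M₂ ρ₁p ρ₂m) ρ₃m h
      = 1 / s * lconv (M₁ + M₂) M₃ (lconv M₁ M₂ ρ₁ ρ₂m) ρ₃m h + -(1 - s) / s * lconv (M₁ + M₂) M₃ (lconv M₁ M₂ ρ₁m ρ₂m) ρ₃m h := by
    rw [hp₁, lconv3_lin_left]
  have xMPM : lconv (M₁ + M₂) M₃ (lconv M₁ M₂ ρ₁m ρ₂p) ρ₃m h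
      = 1 / s * lconv (M₁ + M₂) M₃ (lconv M₁ M₂ ρ₁m ρ₂) ρ₃m h + -(1 - s) / s * lconv (M₁ + M₂) M₃ (lconv M₁ M₂ ρ₁m ρ₂m) ρ₃m h := by
    rw [hp₂, lconv3_lin_mid]
  have xMMP : lconv (M₁ + M₂) M₃ (lconv M₁ M₂ ρ₁m ρ₂m) ρ₃p h
      = 1 / s * lconv (M₁ + M₂) M₃ (lconv M₁ M₂ ρ₁m ρ₂m) ρ₃ h + -(1 - s) / s * lconv (M₁ + M₂) M₃ (lconv M₁ M₂ ρ₁m ρ₂m) ρ₃m h := by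
    rw [hp₃, lconv3_lin_right]
  have xMPP : lconv (M₁ + M₂) M₃ (lconv M₁ M₂ ρ₁m ρ₂p) ρ₃p h
      = 1 / s * (1 / s * lconv (M₁ + M₂) M₃ (lconv M₁ M₂ ρ₁m ρ₂) ρ₃ h + -(1 - s) / s * lconv (M₁ + M₂) M₃ (lconv M₁ M₂ ρ₁m ρ₂m) ρ₃ h)
        + -(1 - s) / s * (1 / s * lconv (M₁ + M₂) M₃ (lconv M₁ M₂ ρ₁m ρ₂) ρ₃m h + -(1 - s) / s * lconv (M₁ + M₂) M₃ (lconv M₁ M₂ ρ₁m ρ₂m) ρ₃m h) := by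
    rw [hp₃, lconv3_lin_right, hp₂, lconv3_lin_mid, lconv3_lin_mid]
  have xPMP : lconv (M₁ + M₂) M₃ (lconv M₁ M₂ ρ₁p ρ₂m) ρ₃p h
      = 1 / s * (1 / s * lconv (M₁ + M₂) M₃ (lconv M₁ M₂ ρ₁ ρ₂m) ρ₃ h + -(1 - s) / s * lconv (M₁ + M₂) M₃ (lconv M₁ M₂ ρ₁m ρ₂m) ρ₃ h)
        + -(1 - s) / s * (1 / s * lconv (M₁ + M₂) M₃ (lconv M₁ M₂ ρ₁ ρ₂m) ρ₃m h + -(1 - s) / s * lconv (M₁ + M₂) M₃ (lconv M₁ M₂ ρ₁m ρ₂m) ρ₃m h) := by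
    rw [hp₃, lconv3_lin_right, hp₁, lconv3_lin_left, lconv3_lin_left]
  have xPPM : lconv (M₁ + M₂) M₃ (lconv M₁ M₂ ρ₁p ρ₂p) ρ₃m h
      = 1 / s * (1 / s * lconv (M₁ + M₂) M₃ (lconv M₁ M₂ ρ₁ ρ₂) ρ₃m h + -(1 - s) / s * lconv (M₁ + M₂) M₃ (lconv M₁ M₂ ρ₁m ρ₂) ρ₃m h)
        + -(1 - s) / s * (1 / s * lconv (M₁ + M₂) M₃ (lconv M₁ M₂ ρ₁ ρ₂m) ρ₃m h + -(1 - s) / s * lconv (M₁ + M₂) M₃ (lconv M₁ M₂ ρ₁m ρ₂m) ρ₃m h) := by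
    rw [hp₂, lconv3_lin_mid, hp₁, lconv3_lin_left, lconv3_lin_left]
  have xPPP : lconv (M₁ + M₂) M₃ (lconv M₁ M₂ ρ₁p ρ₂p) ρ₃p h
      = 1 / s * (1 / s * (1 / s * lconv (M₁ + M₂) M₃ (lconv M₁ M₂ ρ₁ ρ₂) ρ₃ h + -(1 - s) / s * lconv (M₁ + M₂) M₃ (lconv M₁ M₂ ρ₁m ρ₂) ρ₃ h)
          + -(1 - s) / s * (1 / s * lconv (M₁ + M₂) M₃ (lconv M₁ M₂ ρ₁ ρ₂m) ρ₃ h + -(1 - s) / s * lconv (M₁ + M₂) M₃ (lconv M₁ M₂ ρ₁m ρ₂m) ρ₃ h))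
        + -(1 - s) / s * (1 / s * (1 / s * lconv (M₁ + M₂) M₃ (lconv M₁ M₂ ρ₁ ρ₂) ρ₃m h + -(1 - s) / s * lconv (M₁ + M₂) M₃ (lconv M₁ M₂ ρ₁m ρ₂) ρ₃m h)
          + -(1 - s) / s * (1 / s * lconv (M₁ + M₂) M₃ (lconv M₁ M₂ ρ₁ ρ₂m) ρ₃m h + -(1 - s) / s * lconv (M₁ + M₂) M₃ (lconv M₁ M₂ ρ₁m ρ₂m) ρ₃m h)) := by
    rw [hp₃, lconv3_lin_right, hp₂, lconv3_lin_mid, lconv3_lin_mid, hp₁, lconv3_lin_left, lconv3_lin_left, lconv3_lin_left,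
      lconv3_lin_left]
  rw [xPMM, xMPM, xMMP, xMPP, xPMP, xPPM, xPPP]
  set K : ℝ := 1 - (3 * (a * q) - 2) * (1 + s * r) with hK
  have h3r : (3 : ℝ) * (1 + r) ≠ 0 := mul_ne_zero (by norm_num) hr1
  field_simp
  rw [hK]
  ring

/-! ### A1: the tied core above the band (the corner of E*), equal root-part and attached means (`r = 1`, e.g. 2-chains) -/

set_option maxHeartbeats 4000000 in
set_option maxRecDepth 65536 in
/-- **THE ABOVE-BAND TIED-CORE IDENTITY (A1), `r = 1`** (root-part mean = attached sub-forest mean, as for 2-chain trees; the general-`r`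
weights are in the memo §3) — see the file header; the re-tuned trees are `ρ^{(h₂)} = (h₂/s)·ρ + (1 − h₂/s)·ρ⁻`, `h₂ = (3m(1+s) − 3)/2`. [this work] -/
theorem aboveBand_gateCoupling (M₁ M₂ M₃ : ℕ) (ρ₁ ρ₂ ρ₃ ρ₁m ρ₂m ρ₃m ρ₁p ρ₂p ρ₃p : ℕ → ℝ) (q s a : ℝ)
    (h₁M : ∀ h, M₁ < h → ρ₁ h = 0) (h₂M : ∀ h, M₂ < h → ρ₂ h = 0) (h₃M : ∀ h, M₃ < h → ρ₃ h = 0)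
    (hs₁ : ρ₁ = fun k => (1 - s) * ρ₁m k + s * ρ₁p k) (hs₂ : ρ₂ = fun k => (1 - s) * ρ₂m k + s * ρ₂p k)
    (hs₃ : ρ₃ = fun k => (1 - s) * ρ₃m k + s * ρ₃p k)
    (hm : 1 - a * q ≠ 0) (hs0 : s ≠ 0)
    (hK : (2 - (3 * (a * q) - 2) * (1 + s)) ≠ 0) (hK3 : (5 - 3 * (a * q) * (1 + s)) ≠ 0) (hE : (a * q * (1 + s) * (2 + s) - (2 + 3 * s)) ≠ 0) (h : ℕ) :
    gate (lconv (M₁ + M₂) M₃ (lconv M₁ M₂ (gate ρ₁ q) (gate ρ₂ q)) (gate ρ₃ q)) a h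
      = (1 - ((1 - q) / (1 - a * q)) ^ 2 - 3 * ((2 * a * q ^ 2 * (1 - a) * (1 - q)) / ((1 - a * q) * (2 - (3 * (a * q) - 2) * (1 + s)))) - 3 * ((4 * a * q ^ 2 * (1 - a) * (1 - q) * (1 - s) ^ 3 * (3 * (a * q) - 2) * (1 + s)) / (3 * ((1 - a * q) * (2 - (3 * (a * q) - 2) * (1 + s)) * (5 - 3 * (a * q) * (1 + s)) * (-(a * q * (1 + s) * (2 + s) - (2 + 3 * s)))))) - 3 * ((5 * q * (1 - a) * (1 - q) * (1 - s) * (3 * (a * q) - 2) * (((3 * (a * q) - 2) * (1 + s)) - 1) * (a * q * (1 + s) * (1 + 2 * s) - (1 + 4 * s))) / (3 * ((1 - a * q) * (2 - (3 * (a * q) - 2) * (1 + s)) * (5 - 3 * (a * q) * (1 + s)) * (a * q * (1 + s) * (2 + s) - (2 + 3 * s))))) - (4 * q * s ^ 2 * (1 - a) * (1 - q) * (3 * (a * q) - 2) * (((3 * (a * q) - 2) * (1 + s)) - 1)) / ((1 - a * q) * (2 - (3 * (a * q) - 2) * (1 + s)) * (-(a * q * (1 + s) * (2 + s) - (2 +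 3 * s)))))
          * gate (lconv (M₁ + M₂) M₃ (lconv M₁ M₂ ρ₁ ρ₂) ρ₃) (a * q) h
        + ((1 - q) / (1 - a * q)) ^ 2 * lconv (M₁ + M₂) M₃ (lconv M₁ M₂ (gate ρ₁ (a * q)) (gate ρ₂ (a * q))) (gate ρ₃ (a * q)) h
        + (2 * a * q ^ 2 * (1 - a) * (1 - q)) / ((1 - a * q) * (2 - (3 * (a * q) - 2) * (1 + s)))
            * (lconv (M₁ + M₂) M₃ (lconv M₁ M₂ (gate ρ₁p ((3 * (a * q) - 2) * (1 + s) / 2)) ρ₂) ρ₃ h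
              + lconv (M₁ + M₂) M₃ (lconv M₁ M₂ ρ₁ (gate ρ₂p ((3 * (a * q) - 2) * (1 + s) / 2))) ρ₃ h
              + lconv (M₁ + M₂) M₃ (lconv M₁ M₂ ρ₁ ρ₂) (gate ρ₃p ((3 * (a * q) - 2) * (1 + s) / 2)) h)
        + (4 * a * q ^ 2 * (1 - a) * (1 - q) * (1 - s) ^ 3 * (3 * (a * q) - 2) * (1 + s)) / (3 * ((1 - a * q) * (2 - (3 * (a * q) - 2) * (1 + s)) * (5 - 3 * (a * q) * (1 + s)) * (-(a * q * (1 + s) * (2 + s) - (2 + 3 * s)))))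
            * (lconv (M₁ + M₂) M₃ (lconv M₁ M₂ ρ₁m (fun k => ((3 * (a * q) * (1 + s) - 3) / (2 * s)) * ρ₂ k + (1 - (3 * (a * q) * (1 + s) - 3) / (2 * s)) * ρ₂m k)) (fun k => ((3 * (a * q) * (1 + s) - 3) / (2 * s)) * ρ₃ k + (1 - (3 * (a * q) * (1 + s) - 3) / (2 * s)) * ρ₃m k) h
              + lconv (M₁ + M₂) M₃ (lconv M₁ M₂ (fun k => ((3 * (a * q) * (1 + s) - 3) / (2 * s)) * ρ₁ k + (1 - (3 * (a * q) * (1 + s) - 3) / (2 * s)) * ρ₁m k) ρ₂m) (fun k => ((3 * (a * q) * (1 + s) - 3) / (2 * s)) * ρ₃ k + (1 - (3 * (a * q) * (1 + s) - 3) / (2 * s)) * ρ₃m k) h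
              + lconv (M₁ + M₂) M₃ (lconv M₁ M₂ (fun k => ((3 * (a * q) * (1 + s) - 3) / (2 * s)) * ρ₁ k + (1 - (3 * (a * q) * (1 + s) - 3) / (2 * s)) * ρ₁m k) (fun k => ((3 * (a * q) * (1 + s) - 3) / (2 * s)) * ρ₂ k + (1 - (3 * (a * q) * (1 + s) - 3) / (2 * s)) * ρ₂m k)) ρ₃m h)
        + (5 * q * (1 - a) * (1 - q) * (1 - s) * (3 * (a * q) - 2) * (((3 * (a * q) - 2) * (1 + s)) - 1) * (a * q * (1 + s) * (1 + 2 * s) - (1 + 4 * s))) / (3 * ((1 - a * q) * (2 - (3 * (a * q) - 2) * (1 + s)) * (5 - 3 * (a * q) * (1 + s)) * (a * q * (1 + s) * (2 + s) - (2 + 3 * s))))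
            * (gate (lconv (M₁ + M₂) M₃ (lconv M₁ M₂ ρ₁m ρ₂p) ρ₃p) (3 * (a * q) * (1 + s) / 5) h
              + gate (lconv (M₁ + M₂) M₃ (lconv M₁ M₂ ρ₁p ρ₂m) ρ₃p) (3 * (a * q) * (1 + s) / 5) h
              + gate (lconv (M₁ + M₂) M₃ (lconv M₁ M₂ ρ₁p ρ₂p) ρ₃m) (3 * (a * q) * (1 + s) / 5) h)
        + (4 * q * s ^ 2 * (1 - a) * (1 - q) * (3 * (a * q) - 2) * (((3 * (a * q) - 2) * (1 + s)) - 1)) / ((1 - a * q) * (2 - (3 * (a * q) - 2) * (1 + s)) * (-(a * q * (1 + s) * (2 + s) - (2 + 3 * s)))) * gate (lconv (M₁ + M₂) M₃ (lconv M₁ M₂ ρ₁p ρ₂p) ρ₃p) (a * q * (1 + s) / 2) h := by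
  have hp₁ : ρ₁p = fun k => (1 / s) * ρ₁ k + (-(1 - s) / s) * ρ₁m k := by
    funext k
    have e : ρ₁ k = (1 - s) * ρ₁m k + s * ρ₁p k := by rw [hs₁]
    rw [e]; field_simp; ring
  have hp₂ : ρ₂p = fun k => (1 / s) * ρ₂ k + (-(1 - s) / s) * ρ₂m k := by
    funext k
    have e : ρ₂ k = (1 - s) * ρ₂m k + s * ρ₂p k := by rw [hs₂]
    rw [e]; field_simp; ring
  have hp₃ : ρ₃p = fun k => (1 / s) * ρ₃ k + (-(1 - s) / s) * ρ₃m k := by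
    funext k
    have e : ρ₃ k = (1 - s) * ρ₃m k + s * ρ₃p k := by rw [hs₃]
    rw [e]; field_simp; ring
  rw [gate_apply _ a h, lconv3_gate_expand M₁ M₂ M₃ ρ₁ ρ₂ ρ₃ q q q h₁M h₂M h₃M h,
    gate_apply (lconv (M₁ + M₂) M₃ (lconv M₁ M₂ ρ₁ ρ₂) ρ₃) (a * q) h,
    lconv3_gate_expand M₁ M₂ M₃ ρ₁ ρ₂ ρ₃ (a * q) (a * q) (a * q) h₁M h₂M h₃M h,
    l3_version_left M₁ M₂ M₃ ρ₁p ρ₂ ρ₃ _ h₂M h, l3_version_mid M₁ M₂ M₃ ρ₁ ρ₂p ρ₃ _ h₁M h,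
    l3_version_right M₁ M₂ M₃ ρ₁ ρ₂ ρ₃p _ h]
  simp only [gate_apply]
  have xPII : lconv (M₁ + M₂) M₃ (lconv M₁ M₂ ρ₁p ρ₂) ρ₃ h
      = 1 / s * lconv (M₁ + M₂) M₃ (lconv M₁ M₂ ρ₁ ρ₂) ρ₃ h + -(1 - s) / s * lconv (M₁ + M₂) M₃ (lconv M₁ M₂ ρ₁m ρ₂) ρ₃ h := by
    rw [hp₁, lconv3_lin_left]
  have xIPI : lconv (M₁ + M₂) M₃ (lconv M₁ M₂ ρ₁ ρ₂p) ρ₃ h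
      = 1 / s * lconv (M₁ + M₂) M₃ (lconv M₁ M₂ ρ₁ ρ₂) ρ₃ h + -(1 - s) / s * lconv (M₁ + M₂) M₃ (lconv M₁ M₂ ρ₁ ρ₂m) ρ₃ h := by
    rw [hp₂, lconv3_lin_mid]
  have xIIP : lconv (M₁ + M₂) M₃ (lconv M₁ M₂ ρ₁ ρ₂) ρ₃p h
      = 1 / s * lconv (M₁ + M₂) M₃ (lconv M₁ M₂ ρ₁ ρ₂) ρ₃ h + -(1 - s) / s * lconv (M₁ + M₂) M₃ (lconv M₁ M₂ ρ₁ ρ₂) ρ₃m h := by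
    rw [hp₃, lconv3_lin_right]
  have xMPP : lconv (M₁ + M₂) M₃ (lconv M₁ M₂ ρ₁m ρ₂p) ρ₃p h
      = 1 / s * (1 / s * lconv (M₁ + M₂) M₃ (lconv M₁ M₂ ρ₁m ρ₂) ρ₃ h + -(1 - s) / s * lconv (M₁ + M₂) M₃ (lconv M₁ M₂ ρ₁m ρ₂m) ρ₃ h)
        + -(1 - s) / s * (1 / s * lconv (M₁ + M₂) M₃ (lconv M₁ M₂ ρ₁m ρ₂) ρ₃m h + -(1 - s) / s * lconv (M₁ + M₂) M₃ (lconv M₁ M₂ ρ₁m ρ₂m) ρ₃m h) := by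
    rw [hp₃, lconv3_lin_right, hp₂, lconv3_lin_mid, lconv3_lin_mid]
  have xPMP : lconv (M₁ + M₂) M₃ (lconv M₁ M₂ ρ₁p ρ₂m) ρ₃p h
      = 1 / s * (1 / s * lconv (M₁ + M₂) M₃ (lconv M₁ M₂ ρ₁ ρ₂m) ρ₃ h + -(1 - s) / s * lconv (M₁ + M₂) M₃ (lconv M₁ M₂ ρ₁m ρ₂m) ρ₃ h)
        + -(1 - s) / s * (1 / s * lconv (M₁ + M₂) M₃ (lconv M₁ M₂ ρ₁ ρ₂m) ρ₃m h + -(1 - s) / s * lconv (M₁ + M₂) M₃ (lconv M₁ M₂ ρ₁m ρ₂m) ρ₃m h) := by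
    rw [hp₃, lconv3_lin_right, hp₁, lconv3_lin_left, lconv3_lin_left]
  have xPPM : lconv (M₁ + M₂) M₃ (lconv M₁ M₂ ρ₁p ρ₂p) ρ₃m h
      = 1 / s * (1 / s * lconv (M₁ + M₂) M₃ (lconv M₁ M₂ ρ₁ ρ₂) ρ₃m h + -(1 - s) / s * lconv (M₁ + M₂) M₃ (lconv M₁ M₂ ρ₁m ρ₂) ρ₃m h)
        + -(1 - s) / s * (1 / s * lconv (M₁ + M₂) M₃ (lconv M₁ M₂ ρ₁ ρ₂m) ρ₃m h + -(1 - s) / s * lconv (M₁ + M₂) M₃ (lconv M₁ M₂ ρ₁m ρ₂m) ρ₃m h) := by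
    rw [hp₂, lconv3_lin_mid, hp₁, lconv3_lin_left, lconv3_lin_left]
  have xPPP : lconv (M₁ + M₂) M₃ (lconv M₁ M₂ ρ₁p ρ₂p) ρ₃p h
      = 1 / s * (1 / s * (1 / s * lconv (M₁ + M₂) M₃ (lconv M₁ M₂ ρ₁ ρ₂) ρ₃ h + -(1 - s) / s * lconv (M₁ + M₂) M₃ (lconv M₁ M₂ ρ₁m ρ₂) ρ₃ h)
          + -(1 - s) / s * (1 / s * lconv (M₁ + M₂) M₃ (lconv M₁ M₂ ρ₁ ρ₂m) ρ₃ h + -(1 - s) / s * lconv (M₁ + M₂) M₃ (lconv M₁ M₂ ρ₁m ρ₂m) ρ₃ h))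
        + -(1 - s) / s * (1 / s * (1 / s * lconv (M₁ + M₂) M₃ (lconv M₁ M₂ ρ₁ ρ₂) ρ₃m h + -(1 - s) / s * lconv (M₁ + M₂) M₃ (lconv M₁ M₂ ρ₁m ρ₂) ρ₃m h)
          + -(1 - s) / s * (1 / s * lconv (M₁ + M₂) M₃ (lconv M₁ M₂ ρ₁ ρ₂m) ρ₃m h + -(1 - s) / s * lconv (M₁ + M₂) M₃ (lconv M₁ M₂ ρ₁m ρ₂m) ρ₃m h)) := by
    rw [hp₃, lconv3_lin_right, hp₂, lconv3_lin_mid, lconv3_lin_mid, hp₁, lconv3_lin_left, lconv3_lin_left, lconv3_lin_left,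
      lconv3_lin_left]
  -- the re-tuned carriers: first name the two coefficients
  set cI : ℝ := ((3 * (a * q) * (1 + s) - 3) / (2 * s)) with hcI
  set cM : ℝ := (1 - (3 * (a * q) * (1 + s) - 3) / (2 * s)) with hcM
  have yIIM : lconv (M₁ + M₂) M₃ (lconv M₁ M₂ (fun k => cI * ρ₁ k + cM * ρ₁m k) (fun k => cI * ρ₂ k + cM * ρ₂m k)) ρ₃m h
      = cI * (cI * lconv (M₁ + M₂) M₃ (lconv M₁ M₂ ρ₁ ρ₂) ρ₃m h + cM * lconv (M₁ + M₂) M₃ (lconv M₁ M₂ ρ₁ ρ₂m) ρ₃m h)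
        + cM * (cI * lconv (M₁ + M₂) M₃ (lconv M₁ M₂ ρ₁m ρ₂) ρ₃m h + cM * lconv (M₁ + M₂) M₃ (lconv M₁ M₂ ρ₁m ρ₂m) ρ₃m h) := by
    rw [lconv3_lin_left, lconv3_lin_mid, lconv3_lin_mid]
  have yIMI : lconv (M₁ + M₂) M₃ (lconv M₁ M₂ (fun k => cI * ρ₁ k + cM * ρ₁m k) ρ₂m) (fun k => cI * ρ₃ k + cM * ρ₃m k) h
      = cI * (cI * lconv (M₁ + M₂) M₃ (lconv M₁ M₂ ρ₁ ρ₂m) ρ₃ h + cM * lconv (M₁ + M₂) M₃ (lconv M₁ M₂ ρ₁ ρ₂m) ρ₃m h)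
        + cM * (cI * lconv (M₁ + M₂) M₃ (lconv M₁ M₂ ρ₁m ρ₂m) ρ₃ h + cM * lconv (M₁ + M₂) M₃ (lconv M₁ M₂ ρ₁m ρ₂m) ρ₃m h) := by
    rw [lconv3_lin_left, lconv3_lin_right, lconv3_lin_right]
  have yMII : lconv (M₁ + M₂) M₃ (lconv M₁ M₂ ρ₁m (fun k => cI * ρ₂ k + cM * ρ₂m k)) (fun k => cI * ρ₃ k + cM * ρ₃m k) h
      = cI * (cI * lconv (M₁ + M₂) M₃ (lconv M₁ M₂ ρ₁m ρ₂) ρ₃ h + cM * lconv (M₁ + M₂) M₃ (lconv M₁ M₂ ρ₁m ρ₂) ρ₃m h)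
        + cM * (cI * lconv (M₁ + M₂) M₃ (lconv M₁ M₂ ρ₁m ρ₂m) ρ₃ h + cM * lconv (M₁ + M₂) M₃ (lconv M₁ M₂ ρ₁m ρ₂m) ρ₃m h) := by
    rw [lconv3_lin_mid, lconv3_lin_right, lconv3_lin_right]
  rw [xPII, xIPI, xIIP, xMPP, xPMP, xPPM, xPPP, yIIM, yIMI, yMII]
  set K2 : ℝ := (2 - (3 * (a * q) - 2) * (1 + s)) with hK2
  set K3' : ℝ := (5 - 3 * (a * q) * (1 + s)) with hK3'
  set K4 : ℝ := (a * q * (1 + s) * (2 + s) - (2 + 3 * s)) with hK4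
  have h2s : (2 : ℝ) * s ≠ 0 := mul_ne_zero (by norm_num) hs0
  have hK4n : -K4 ≠ 0 := neg_ne_zero.mpr hE
  field_simp
  rw [hcI, hcM, hK2, hK3', hK4]
  field_simp
  ring

/-! ### Sums and signs of the weights (inputs for the DEC-consequence files) -/

/-- **B1: the weights sum to one** (`w_N + w_P + 3·(w_U/3) + 3·(w_UUD/3) + 3·(w_UDD/3) + w_DDD = 1`; denominators nonzero). [this work] -/
theorem belowBand_weights_sum (q s a r : ℝ) (hs1 : 1 - s ≠ 0) (hκ : 1 - (3 * (a * q) - 2) * (1 + s * r) ≠ 0) :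
    (1 - ((1 - q) / (1 - a * q)) ^ 2
            - (3 * a * q ^ 2 * (1 - a) * (1 - q)) / ((1 - a * q) * (1 - (3 * (a * q) - 2) * (1 + s * r)))
            - (q * s * (1 - s) * (1 - a) * (1 - q) * (3 * (a * q) - 2) * (3 + r)) / ((1 - a * q) * (1 - (3 * (a * q) - 2) * (1 + s * r)))
            - (2 * q * s ^ 2 * (1 - a) * (1 - q) * (3 * (a * q) - 2) * (3 + 2 * r)) / ((1 - a * q) * (1 - (3 * (a * q) - 2) * (1 + s * r)))
            - (3 * q * s ^ 3 * (1 - a) * (1 - q) * (3 * (a * q) - 2) * (1 + r)) / ((1 - s) * (1 - a * q) * (1 - (3 * (a * q) - 2) * (1 + s * r))))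
      + ((1 - q) / (1 - a * q)) ^ 2 + 3 * ((a * q ^ 2 * (1 - a) * (1 - q)) / ((1 - a * q) * (1 - (3 * (a * q) - 2) * (1 + s * r)))) + 3 * ((q * s * (1 - s) * (1 - a) * (1 - q) * (3 * (a * q) - 2) * (3 + r)) / (3 * ((1 - a * q) * (1 - (3 * (a * q) - 2) * (1 + s * r))))) + 3 * ((2 * q * s ^ 2 * (1 - a) * (1 - q) * (3 * (a * q) - 2) * (3 + 2 * r)) / (3 * ((1 - a * q) * (1 - (3 * (a * q) - 2) * (1 + s * r)))))
      + (3 * q * s ^ 3 * (1 - a) * (1 - q) * (3 * (a * q) - 2) * (1 + r)) / ((1 - s) * (1 - a * q) * (1 - (3 * (a * q) - 2) * (1 + s * r))) = 1 := by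
  set K : ℝ := 1 - (3 * (a * q) - 2) * (1 + s * r) with hK
  field_simp
  ring

/-- **B1: the five explicit weights are nonnegative** for `0 ≤ a ≤ 1`, `0 ≤ q ≤ 1`, `0 ≤ s < 1`, `0 ≤ r`, `aq < 1`, `3aq ≥ 2` (pinned) and
`κ = (3aq−2)(1+sr) < 1` (below the top of the band); `w_N ≥ 0` is the family's region condition and stays a hypothesis downstream. [this work] -/
theorem belowBand_weights_nonneg (q s a r : ℝ) (ha0 : 0 ≤ a) (ha1 : a ≤ 1) (hq0 : 0 ≤ q) (hq1 : q ≤ 1) (hs0 : 0 ≤ s) (hs1 : s < 1)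
    (hr0 : 0 ≤ r) (hm1 : a * q < 1) (hpin : 2 ≤ 3 * (a * q)) (hκ : (3 * (a * q) - 2) * (1 + s * r) < 1) :
    0 ≤ ((1 - q) / (1 - a * q)) ^ 2 ∧ 0 ≤ (a * q ^ 2 * (1 - a) * (1 - q)) / ((1 - a * q) * (1 - (3 * (a * q) - 2) * (1 + s * r))) ∧ 0 ≤ (q * s * (1 - s) * (1 - a) * (1 - q) * (3 * (a * q) - 2) * (3 + r)) / (3 * ((1 - a * q) * (1 - (3 * (a * q) - 2) * (1 + s * r)))) ∧ 0 ≤ (2 * q * s ^ 2 * (1 - a) * (1 - q) * (3 * (a * q) - 2) * (3 + 2 * r)) / (3 * ((1 - a * q) * (1 - (3 * (a * q) - 2) * (1 + s * r))))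
      ∧ 0 ≤ (3 * q * s ^ 3 * (1 - a) * (1 - q) * (3 * (a * q) - 2) * (1 + r)) / ((1 - s) * (1 - a * q) * (1 - (3 * (a * q) - 2) * (1 + s * r))) := by
  have hm : 0 < 1 - a * q := by linarith
  have hk : 0 < 1 - (3 * (a * q) - 2) * (1 + s * r) := by linarith
  have h1a : 0 ≤ 1 - a := by linarith
  have h1q : 0 ≤ 1 - q := by linarith
  have h1s : 0 < 1 - s := by linarith
  have hp : 0 ≤ 3 * (a * q) - 2 := by linarith
  refine ⟨sq_nonneg _, ?_, ?_, ?_, ?_⟩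
  · exact div_nonneg (by positivity) (by positivity)
  · exact div_nonneg (by positivity) (by positivity)
  · exact div_nonneg (by positivity) (by positivity)
  · exact div_nonneg (by positivity) (by positivity)

/-- **A1 (`r = 1`): the weights sum to one**. [this work] -/
theorem aboveBand_weights_sum (q s a : ℝ) :
    (1 - ((1 - q) / (1 - a * q)) ^ 2 - 3 * ((2 * a * q ^ 2 * (1 - a) * (1 - q)) / ((1 - a * q) * (2 - (3 * (a * q) - 2) * (1 + s)))) - 3 * ((4 * a * q ^ 2 * (1 - a) * (1 - q) * (1 - s) ^ 3 * (3 * (a * q) - 2) * (1 + s)) / (3 * ((1 - a * q) * (2 - (3 * (a * q) - 2) * (1 + s)) * (5 - 3 * (a * q) * (1 + s)) * (-(a * q * (1 + s) * (2 + s) - (2 + 3 * s)))))) - 3 * ((5 * q * (1 - a) * (1 - q) * (1 - s) * (3 * (a * q) - 2) * (((3 * (a * q) - 2) * (1 + s)) - 1) * (a * q * (1 + s) * (1 + 2 * s) - (1 + 4 * s))) / (3 * ((1 - a * q) * (2 - (3 * (a * q) - 2) * (1 + s)) * (5 - 3 * (a * q) * (1 + s)) * (a * q * (1 + s) * (2 +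 s) - (2 + 3 * s))))) - (4 * q * s ^ 2 * (1 - a) * (1 - q) * (3 * (a * q) - 2) * (((3 * (a * q) - 2) * (1 + s)) - 1)) / ((1 - a * q) * (2 - (3 * (a * q) - 2) * (1 + s)) * (-(a * q * (1 + s) * (2 + s) - (2 + 3 * s)))))
      + ((1 - q) / (1 - a * q)) ^ 2 + 3 * ((2 * a * q ^ 2 * (1 - a) * (1 - q)) / ((1 - a * q) * (2 - (3 * (a * q) - 2) * (1 + s)))) + 3 * ((4 * a * q ^ 2 * (1 - a) * (1 - q) * (1 - s) ^ 3 * (3 * (a * q) - 2) * (1 + s)) / (3 * ((1 - a * q) * (2 - (3 * (a * q) - 2) * (1 + s)) * (5 - 3 * (a * q) * (1 + s)) * (-(a * q * (1 + s) * (2 + s) - (2 + 3 * s)))))) + 3 * ((5 * q * (1 - a) * (1 - q) * (1 - s) * (3 * (a * q) - 2) * (((3 * (a * q) - 2) * (1 + s)) - 1) * (a * q * (1 + s) * (1 + 2 * s) - (1 + 4 * s))) / (3 * ((1 - a * q) * (2 - (3 * (a * q) - 2) * (1 + s)) * (5 - 3 * (a * q) * (1 + s)) * (a * q * (1 + s)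 * (2 + s) - (2 + 3 * s)))))
      + (4 * q * s ^ 2 * (1 - a) * (1 - q) * (3 * (a * q) - 2) * (((3 * (a * q) - 2) * (1 + s)) - 1)) / ((1 - a * q) * (2 - (3 * (a * q) - 2) * (1 + s)) * (-(a * q * (1 + s) * (2 + s) - (2 + 3 * s)))) = 1 := by
  ring

/-- **A1 (`r = 1`): the five explicit weights are nonnegative** for `0 ≤ a ≤ 1`, `0 ≤ q ≤ 1`, `0 ≤ s < 1`, `aq < 1`, `3aq ≥ 2`, above the band
`κ = (3aq−2)(1+s) ≥ 1`, below the box-level boundary `E = aq(1+s)(2+s) − (2+3s) < 0` (which gives `3aq(1+s) < 5` and `F = aq(1+s)(1+2s) − (1+4s) < 0`),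
and `κ < 2`; `w_N ≥ 0` stays a hypothesis downstream. [this work] -/
theorem aboveBand_weights_nonneg (q s a : ℝ) (ha0 : 0 ≤ a) (ha1 : a ≤ 1) (hq0 : 0 ≤ q) (hq1 : q ≤ 1) (hs0 : 0 ≤ s) (hs1 : s < 1)
    (hm1 : a * q < 1) (hpin : 2 ≤ 3 * (a * q)) (hκ1 : 1 ≤ ((3 * (a * q) - 2) * (1 + s))) (hκ2 : ((3 * (a * q) - 2) * (1 + s)) < 2) (hE : (a * q * (1 + s) * (2 + s) - (2 + 3 * s)) < 0) :
    0 ≤ ((1 - q) / (1 - a * q)) ^ 2 ∧ 0 ≤ (2 * a * q ^ 2 * (1 - a) * (1 - q)) / ((1 - a * q) * (2 - (3 * (a * q) - 2) * (1 + s))) ∧ 0 ≤ (4 * a * q ^ 2 * (1 - a) * (1 - q) * (1 - s) ^ 3 * (3 * (a * q) - 2) * (1 + s)) / (3 * ((1 - a * q) * (2 - (3 * (a * q) - 2) * (1 + s)) * (5 - 3 * (a * q) * (1 + s)) * (-(a * q * (1 + s) * (2 + s) - (2 + 3 * s)))))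
      ∧ 0 ≤ (5 * q * (1 - a) * (1 - q) * (1 - s) * (3 * (a * q) - 2) * (((3 * (a * q) - 2) * (1 + s)) - 1) * (a * q * (1 + s) * (1 + 2 * s) - (1 + 4 * s))) / (3 * ((1 - a * q) * (2 - (3 * (a * q) - 2) * (1 + s)) * (5 - 3 * (a * q) * (1 + s)) * (a * q * (1 + s) * (2 + s) - (2 + 3 * s))))
      ∧ 0 ≤ (4 * q * s ^ 2 * (1 - a) * (1 - q) * (3 * (a * q) - 2) * (((3 * (a * q) - 2) * (1 + s)) - 1)) / ((1 - a * q) * (2 - (3 * (a * q) - 2) * (1 + s)) * (-(a * q * (1 + s) * (2 + s) - (2 + 3 * s)))) := by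
  have hm : 0 < 1 - a * q := by linarith
  have hK : 0 < (2 - (3 * (a * q) - 2) * (1 + s)) := by linarith
  have h1a : 0 ≤ 1 - a := by linarith
  have h1q : 0 ≤ 1 - q := by linarith
  have h1s : 0 < 1 - s := by linarith
  have hp : 0 ≤ 3 * (a * q) - 2 := by linarith
  have hk1 : 0 ≤ ((3 * (a * q) - 2) * (1 + s)) - 1 := by linarith
  have hnE : 0 < -(a * q * (1 + s) * (2 + s) - (2 + 3 * s)) := by linarith
  -- `E < 0 ⟹ 3aq(1+s) < 5` and `F < 0`
  have hS5 : 0 < (5 - 3 * (a * q) * (1 + s)) := by nlinarith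
  have hF : (a * q * (1 + s) * (1 + 2 * s) - (1 + 4 * s)) ≤ 0 := by nlinarith
  refine ⟨sq_nonneg _, ?_, ?_, ?_, ?_⟩
  · exact div_nonneg (by positivity) (by positivity)
  · exact div_nonneg (by positivity) (by positivity)
  · -- numerator ≤ 0 (factor `F ≤ 0`), denominator ≤ 0 (factor `E < 0`)
    apply div_nonneg_of_nonpos
    · have h1 : 0 ≤ 5 * q * (1 - a) * (1 - q) * (1 - s) * (3 * (a * q) - 2) * (((3 * (a * q) - 2) * (1 + s)) - 1) := by positivity
      exact mul_nonpos_of_nonneg_of_nonpos h1 hF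
    · have h2 : 0 ≤ 3 * ((1 - a * q) * (2 - (3 * (a * q) - 2) * (1 + s)) * (5 - 3 * (a * q) * (1 + s))) := by positivity
      nlinarith
  · exact div_nonneg (by positivity) (by positivity)

end LawDec

end Quant

end Summit.CriticalPhenomena.PercolationContinuityZ3.Theorems
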